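import Literature.AnabelianGeometry.SemiGraphs.ApproximatorBridgeProofs
import Literature.AnabelianGeometry.Anabelioids.BCatBranchConjugacy
import HarnessLib

/-!
# [SemiAnbd] §2/§3: total elevation transfers from the profinite presentation to `𝒢.toAnab`

Mochizuki, *Semi-graphs of anabelioids*, Publ. RIMS **42** (2006), Def. 2.4 (i) p. 25
[cite: MochizukiSemiAnbd2006, Def 2.4(i) p.25]: a vertex `v` is *elevated* if "for every integer
`M ≥ 1`, there exists a `π₁`-epimorphic approximator `G → G'` for `G` such that there exists a subgroup
`N_M ⊆ π̂₁(G'_v)` of order `≥ M` which has trivial intersection with all of the conjugates, in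
`π̂₁(G'_v)`, of all of the `π̂₁(G'_e)` [where `e` ranges over the edges abutting to `v`]".  The tree types
this twice: for the profinite presentation (`ProfiniteSemiGraph.IsElevatedVertex`, finite groups `F_v`,
`TemperedVerticial.lean`) and for semi-graphs of anabelioids (`SemiGraphOfAnabelioids.IsElevated`, for
every basepoint `F` of `𝒢'_v` and every representative of `Π'_b`, `Commensurability.lean`).  This
proof-only file closes the LAST item of the hypothesis-side dictionary §3 ⇒ §2 (abc-iut L3 row G29,
after injective type / verticially slim / totally aloof / totally estranged / locally open /
quasi-coherent): `isElevatedVertex_toAnab`, `isTotallyElevated_toAnab`.  Route (abc-iut-L3-t12's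
recipe): the §3 approximator `A` gives the §2 `π₁`-epimorphic approximator `A.toHom.toAnab`
(`toAnab_isPi1EpiApproximator`); for a basepoint `F` of `B(F_v)` the identification
`θ : Aut F ≃* F_v` of `exists_mulEquiv_forall_range_conj` carries EVERY §2 branch subgroup to a
CONJUGATE of `range (brF)`, so `N_M` transported by `θ⁻¹` works.  Nothing here takes a side on
[IUTchIII] Cor. 3.12.
-/

noncomputable section

namespace Literature.AnabelianGeometry.SemiGraphs

open CategoryTheory
open Literature.AnabelianGeometry.Anabelioids
open Literature.AlgebraicGeometry.Frobenioids (BCat)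
open scoped Pointwise

universe u

/-- Images of conjugates are conjugates of images: `f (g • H) = f(g) • f(H)` for the conjugation
action. [folklore] -/
private theorem Subgroup.map_toConjAct_smul {G K : Type*} [Group G] [Group K] (f : G →* K) (g : G)
    (H : Subgroup G) :
    (ConjAct.toConjAct g • H).map f = ConjAct.toConjAct (f g) • H.map f := by
  ext x
  simp only [Subgroup.mem_map, Subgroup.mem_smul_pointwise_iff_exists, ConjAct.toConjAct_smul]
  constructor
  · rintro ⟨y, ⟨z, hz, rfl⟩, rfl⟩
    exact ⟨f z, ⟨z, hz, rfl⟩, by rw [map_mul, map_mul, map_inv]⟩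
  · rintro ⟨y, ⟨z, hz, rfl⟩, rfl⟩
    exact ⟨g * z * g⁻¹, ⟨z, hz, rfl⟩, by rw [map_mul, map_mul, map_inv]⟩

/-- The conjugation action on subgroups is the image under `MulAut.conj`. [folklore] -/
private theorem Subgroup.toConjAct_smul_eq_map_conj {G : Type*} [Group G] (g : G) (H : Subgroup G) :
    ConjAct.toConjAct g • H = H.map (MulAut.conj g).toMonoidHom := by
  ext x
  simp only [Subgroup.mem_map, Subgroup.mem_smul_pointwise_iff_exists, ConjAct.toConjAct_smul,
    MulEquiv.coe_toMonoidHom, MulAut.conj_apply]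

namespace ProfiniteSemiGraph

variable (𝒢 : ProfiniteSemiGraph.{u})

/-- **§3 elevated ⇒ §2 elevated at a vertex** ([SemiAnbd] Def. 2.4 (i) p. 25): the approximator is
`A.toHom.toAnab`, and for every basepoint `F` of `B(F_v)` the subgroup `N_M` is transported along
`θ : Aut F ≃* F_v` (`exists_mulEquiv_forall_range_conj`), under which every §2 branch subgroup at
`(F, F_e, α)` is a conjugate of `range (F_e → F_v)`. [cite: MochizukiSemiAnbd2006, Def 2.4(i) p.25] -/
theorem isElevatedVertex_toAnab (v : 𝒢.graph.Vertex) (h : 𝒢.IsElevatedVertex v) :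
    𝒢.toAnab.IsElevated v := by
  classical
  intro M _hM
  obtain ⟨A, hA, N, hMN, hN⟩ := h M
  refine ⟨A.toProfinite.toAnab, A.toHom.toAnab, A.toAnab_isPi1EpiApproximator hA, ?_⟩
  intro F hF
  -- `θ : Aut F ≃* F_v` carrying branch subgroups to conjugates of `range brF`
  obtain ⟨θ, hθ⟩ := @exists_mulEquiv_forall_range_conj (A.toProfinite.Gv v) _ _
    (A.toProfinite.isTopologicalGroupV v) (A.toProfinite.compactSpaceV v)
    (A.toProfinite.totallyDisconnectedSpaceV v) F hF
  refine ⟨N.map θ.symm.toMonoidHom, ?_, ?_, ?_⟩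
  · -- finite: `F_v` is finite
    haveI : Finite N := inferInstance
    exact Finite.of_equiv N (θ.symm.subgroupMap N).toEquiv
  · rw [Subgroup.card_map_of_injective θ.symm.injective]
    exact hMN
  · intro b hb Fe hFe α g
    obtain ⟨x, hx⟩ := @hθ (A.toProfinite.Ge (𝒢.graph.edgeOf b)) _ _
      (A.toProfinite.isTopologicalGroupE _) (A.toProfinite.compactSpaceE _)
      (A.toProfinite.totallyDisconnectedSpaceE _) (A.toProfinite.brHom b v hb) Fe hFe α
    -- `hx` : the §2 branch subgroup at `(F, Fe, α)` maps under `θ` to `x • range (brF b)`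
    change (A.toProfinite.toAnab.branchSubgroup F b hb Fe α).map θ.toMonoidHom =
      ConjAct.toConjAct x • (A.toProfinite.brHom b v hb).toMonoidHom.range at hx
    -- hence `θ (g • Π'_b) = (θ g · x) • range (brF b) = conj_{θ g · x} (range (brF b))`
    have e1 : (ConjAct.toConjAct g • A.toProfinite.toAnab.branchSubgroup F b hb Fe α).map
          θ.toMonoidHom =
        ((A.toProfinite.brHom b v hb).toMonoidHom.range).map
          (MulAut.conj (θ.toMonoidHom g * x)).toMonoidHom :=
      (Subgroup.map_toConjAct_smul θ.toMonoidHom g _).trans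
        ((congrArg (fun S => ConjAct.toConjAct (θ.toMonoidHom g) • S) hx).trans
          ((smul_smul _ _ _).trans (Subgroup.toConjAct_smul_eq_map_conj _ _)))
    -- elementwise: `y ∈ θ⁻¹ N ⊓ g • Π'_b` forces `θ y ∈ N ⊓ conj (range brF) = ⊥`
    refine (Subgroup.eq_bot_iff_forall _).mpr fun y hy => ?_
    obtain ⟨hy1, hy2⟩ := Subgroup.mem_inf.mp hy
    obtain ⟨n, hn, rfl⟩ := Subgroup.mem_map.mp hy1
    have hθn : θ.toMonoidHom (θ.symm.toMonoidHom n) = n := θ.apply_symm_apply n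
    have hmem1 : θ.toMonoidHom (θ.symm.toMonoidHom n) ∈ N := (congrArg (· ∈ N) hθn).mpr hn
    have hmem2 : θ.toMonoidHom (θ.symm.toMonoidHom n) ∈
        ((A.toProfinite.brHom b v hb).toMonoidHom.range).map
          (MulAut.conj (θ.toMonoidHom g * x)).toMonoidHom :=
      (congrArg (fun S => θ.toMonoidHom (θ.symm.toMonoidHom n) ∈ S) e1).mp
        (Subgroup.mem_map.mpr ⟨_, hy2, rfl⟩)
    have hbot : θ.toMonoidHom (θ.symm.toMonoidHom n) ∈ (⊥ : Subgroup (A.toProfinite.Gv v)) :=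
      (hN b hb (θ.toMonoidHom g * x)).le (Subgroup.mem_inf.mpr ⟨hmem1, hmem2⟩)
    exact θ.symm.map_eq_one_iff.mpr (hθn.symm.trans (Subgroup.mem_bot.mp hbot))

/-- **§3 totally elevated ⇒ §2 totally elevated** ([SemiAnbd] Def. 2.4 (i) p. 25) — the last
hypothesis of Proposition 3.6 / Theorem 3.7 transferred to `𝒢.toAnab`.
[cite: MochizukiSemiAnbd2006, Def 2.4(i) p.25] -/
theorem isTotallyElevated_toAnab (h : 𝒢.IsTotallyElevated) : 𝒢.toAnab.IsTotallyElevated :=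
  ⟨fun v => 𝒢.isElevatedVertex_toAnab v (h v)⟩

end ProfiniteSemiGraph

end Literature.AnabelianGeometry.SemiGraphs

end
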